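import Literature.NumberTheory.EllipticCurves.WeilPairing
import Literature.NumberTheory.EllipticCurves.IsogenyDegree
import HarnessLib

/-!
# The Weil pairing and isogenies (Silverman, *AEC*, Prop. III.8.1–8.2): named fact

Topic `NumberTheory/EllipticCurves` (trunk T-ELLARITH). The input of the decomposition of the
named fact `WeierstrassCurve.Isogeny.det_tateModule_map_eq_deg`
(`Literature.NumberTheory.EllipticCurves.FrobeniusEndomorphism`; Silverman, *AEC*, 2nd ed.,
Prop. III.8.6, `det(φ_ℓ) = deg φ`, "whose proof uses the Weil pairing", PDF p. 92): its
consumer `Literature.NumberTheory.EllipticCurves.FrobeniusEndomorphismDetDegProofs` proves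
Prop. III.8.6 from the present fact alone.

The tree's `WeierstrassCurve.exists_weilPairing W m` (`WeilPairing`, Prop. III.8.1 (a)–(d)) records
the existence of *a* bilinear, alternating, non-degenerate, Galois-equivariant pairing on `E[m]`,
which is all that `det ρ̄ = χ̄` needs. The proof of Prop. III.8.6 needs one more printed property
of the Weil pairing, Prop. III.8.2: an isogeny and its dual are adjoint,
`e_m(S, φ̂(T)) = e_m(φ(S), T)`, where (Thm. III.6.1(b), and the display on PDF p. 78: "choose any
`P ∈ E₁` satisfying `φ(P) = Q`. Then `[φ̂](Q) = [deg φ](P)`") the dual acts on points by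
`φ̂(φ P) = [deg φ] P`. Since adjointness concerns the *same* pairing, it cannot be bolted onto an
existence statement after the fact; this file therefore vendors the conjunction
"Prop. III.8.1 (a)–(d) and Prop. III.8.2 (for `E₁ = E₂ = E`, with `φ̂(φ P) = [deg φ] P`)" as one
named fact, `WeierstrassCurve.exists_weilPairing_adjoint W m`, stated without reference to the
dual isogeny as a map (which the tree does not have), and proves that it refines the tree's fact
(`exists_weilPairing_of_adjoint`), so that a future discharge serves every consumer of either.

## Contents

* `WeierstrassCurve.exists_weilPairing_adjoint W m` — **named fact** (Silverman, *AEC*,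
  Prop. III.8.1 (a)–(d) with Prop. III.8.2 and Thm. III.6.1(b)): for `E / K` elliptic, `m ≥ 2`
  with `char K ∤ m`, there is a pairing `e` on the geometric `m`-torsion `E[m] = E(K̄)[m]` with
  values `m`-th roots of unity in `K̄`, bilinear, alternating, non-degenerate, `Γ_K`-equivariant,
  and such that `e(φ S, φ P) = e(S, [deg φ] P)` for every isogeny `φ : E → E` over `K`, every
  `S ∈ E[m]` and every `P ∈ E(K̄)` with `φ P ∈ E[m]` (Prop. III.8.2 at `T = φ P`, with
  `φ̂(T) = [deg φ] P` by Thm. III.6.1(b)).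
* `WeierstrassCurve.exists_weilPairing_of_adjoint`: the fact implies `exists_weilPairing W m`.

## Faithfulness of the encoding

The pairing is recorded as a function `E(K̄) → E(K̄) → K̄` all of whose asserted properties
quantify over points of `E[m]` (values elsewhere are irrelevant junk, as for any extension of a
function on `E[m] × E[m]`); `geomTorsion W m` is `E(K̄)[m]` (`GaloisAction`), `φ.deg` is
Silverman's `deg φ = [K̄(E) : φ^* K̄(E)]` (`IsogenyDegree`), and `[n]` is `P ↦ n • P`.
Prop. III.8.2 is printed for `φ : E₁ → E₂`, `S ∈ E₁[m]`, `T ∈ E₂[m]`: "`e_m(S, φ̂(T)) =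
e_m(φ(S), T)`"; only its case `E₁ = E₂ = E` is vendored (the one used on p. 92), with `T = φ P`
and `φ̂(T) = [deg φ] P` (Thm. III.6.1(b): "`φ̂` equals the composition `E₂ → Div⁰(E₂) →φ^*
Div⁰(E₁) →sum E₁`", computed on p. 79 as `[deg φ] P` for any `P ∈ φ⁻¹(Q)`; also the display
introducing Thm. III.6.1, p. 78). For `T ∈ E[m]` of the form `φ P` this covers all of
Prop. III.8.2 on `E`, isogenies being onto (II.2.3); and `[deg φ] P ∈ E[m]` then holds
(`m [deg φ] P = [deg φ](m P)` with `m P ∈ ker φ`, killed by `#ker φ ∣ deg φ`), though the fact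
need not say so. Silverman's standing hypothesis "`K` perfect" (Ch. I) is not imposed: every
object here lives over `K̄ = AlgebraicClosure K`, which is perfect, the curve and isogenies being
defined over the subfield `K`; for an imperfect `K`, `Γ_K = Aut(K̄/K)` is the absolute Galois
group of the perfect closure of `K` in `K̄`, over which `E` is still defined, so (d) is the
printed statement for that perfect field. The fact asserts the existence of a pairing with the
listed properties (the source constructs a specific one); `2 ≤ m`, `(m : K) ≠ 0` are as in the
tree's `exists_weilPairing`.

## What is not proved, and why (D-0014)

The construction of `e_m` (functions `f_T`, `g_T` with `div f_T = m(T) - m(O)`,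
`g_T^m = f_T ∘ [m]`; III.§8, PDF p. 88) needs divisors of functions on `E` over `K̄`, Cor. III.3.5
(`∑ nᵢ(Pᵢ)` principal iff `∑ nᵢ = 0` and `∑ [nᵢ]Pᵢ = O`), the pull-back of divisors along `[m]`
and `φ` with their ramification indices (Prop. II.2.6, Thm. III.4.10) — this is how Thm. III.6.1(b)
enters — and the Galois theory of `K̄(E)/[m]^* K̄(E)` (Thm. III.4.10(b), for (c)). The tree has
the places of `K̄(E)` (`Literature.NumberTheory.DiophantineGeometry.WeierstrassFunctionFieldPlaces`),
`deg (f) = 0` (`Literature.NumberTheory.DiophantineGeometry.AlgFunctionField.degree_principalDivisor_holds`), translations `τ_T^*`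
(`FunctionFieldTranslation`) and `#ker φ ∣ deg φ`, but not yet this superstructure; the plan is
recorded with the consumer.

## References

* [SilvermanAEC2009] J. H. Silverman, *The Arithmetic of Elliptic Curves*, 2nd ed., GTM 106,
  Springer 2009 (held: `book:silverman2009-arithmetic-elliptic-curves-2nd-ed`): III.§8, the
  construction of `e_m` and Prop. III.8.1 (a)–(e) with proof (PDF pp. 88–90), Prop. III.8.2 with
  proof (PDF p. 90), Thm. III.6.1 (a)–(b) with proof (PDF pp. 78–79), proof of Prop. III.8.6
  (PDF p. 92), Thm. II.2.3.

## Design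

`noncomputable section`, `open scoped Classical`, one universe `u`, deliberate dot-notation
extensions in `namespace WeierstrassCurve` next to `exists_weilPairing`; membership hypotheses
`S ∈ geomTorsion W m` rather than the subtype, so that images `φ S` of torsion points need no
repackaging (the subtype form of `exists_weilPairing` is recovered in
`exists_weilPairing_of_adjoint`).
-/

noncomputable section

open scoped Classical

universe u

namespace WeierstrassCurve

variable {K : Type u} [Field K]

/-- **Silverman, *AEC*, Prop. III.8.1 (a)–(d) with Prop. III.8.2 (case `E₁ = E₂ = E`) and
Thm. III.6.1(b): the Weil `e_m`-pairing and its compatibility with isogenies.** For an elliptic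
curve `E / K` (`W`, `[W.IsElliptic]`) and an integer `m ≥ 2` prime to `char K` (`(m : K) ≠ 0`),
there is a pairing `e` on `E[m] = E(K̄)[m]` (`geomTorsion W m`) with values in `K̄` such that, for
all `S, S₁, S₂, T, T₁, T₂ ∈ E[m]`: `e(S, T)^m = 1` (values in `μ_m`); (a) bilinear:
`e(S₁ + S₂, T) = e(S₁, T) e(S₂, T)`, `e(S, T₁ + T₂) = e(S, T₁) e(S, T₂)`; (b) alternating:
`e(T, T) = 1`; (c) non-degenerate: if `e(S, T) = 1` for all `S ∈ E[m]` then `T = O`; (d) Galois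
invariant: `e(S^σ, T^σ) = e(S, T)^σ` for `σ ∈ Γ_K`; and (Prop. III.8.2, "`e_m(S, φ̂(T)) =
e_m(φ(S), T)`", at `T = φ P`, where `φ̂(φ P) = [deg φ] P` by Thm. III.6.1(b)) for every isogeny
`φ : E → E` over `K` (`Isogeny W W`, `deg φ = φ.deg` of `IsogenyDegree`), every `S ∈ E[m]` and
every `P ∈ E(K̄)` with `φ P ∈ E[m]`: `e(φ S, φ P) = e(S, deg φ • P)`. See the module docstring
for the (vacuous) rôle of values off `E[m]` and for `K` imperfect.
[cite: SilvermanAEC2009, Prop. III.8.1 (a)–(d), Prop. III.8.2, Thm. III.6.1(b)] -/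
def exists_weilPairing_adjoint (W : WeierstrassCurve K) (m : ℕ) : Prop :=
  ∀ [W.IsElliptic], 2 ≤ m → (m : K) ≠ 0 →
    ∃ e : W.geomPoints → W.geomPoints → AlgebraicClosure K,
      (∀ S ∈ geomTorsion W m, ∀ T ∈ geomTorsion W m, e S T ^ m = 1) ∧
      (∀ S₁ ∈ geomTorsion W m, ∀ S₂ ∈ geomTorsion W m, ∀ T ∈ geomTorsion W m,
        e (S₁ + S₂) T = e S₁ T * e S₂ T) ∧
      (∀ S ∈ geomTorsion W m, ∀ T₁ ∈ geomTorsion W m, ∀ T₂ ∈ geomTorsion W m,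
        e S (T₁ + T₂) = e S T₁ * e S T₂) ∧
      (∀ T ∈ geomTorsion W m, e T T = 1) ∧
      (∀ T ∈ geomTorsion W m, (∀ S ∈ geomTorsion W m, e S T = 1) → T = 0) ∧
      (∀ σ : Field.absoluteGaloisGroup K, ∀ S ∈ geomTorsion W m, ∀ T ∈ geomTorsion W m,
        e (σ • S) (σ • T) = σ • e S T) ∧
      (∀ φ : Isogeny W W, ∀ S ∈ geomTorsion W m, ∀ P : W.geomPoints, φ P ∈ geomTorsion W m →
        e (φ S) (φ P) = e S (φ.deg • P))

variable (W : WeierstrassCurve K) (m : ℕ)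

/-- Unfolding lemma for `exists_weilPairing_adjoint` (`Iff.rfl`). [folklore] -/
theorem exists_weilPairing_adjoint_iff :
    W.exists_weilPairing_adjoint m ↔
      ∀ [W.IsElliptic], 2 ≤ m → (m : K) ≠ 0 →
        ∃ e : W.geomPoints → W.geomPoints → AlgebraicClosure K,
          (∀ S ∈ geomTorsion W m, ∀ T ∈ geomTorsion W m, e S T ^ m = 1) ∧
          (∀ S₁ ∈ geomTorsion W m, ∀ S₂ ∈ geomTorsion W m, ∀ T ∈ geomTorsion W m,
            e (S₁ + S₂) T = e S₁ T * e S₂ T) ∧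
          (∀ S ∈ geomTorsion W m, ∀ T₁ ∈ geomTorsion W m, ∀ T₂ ∈ geomTorsion W m,
            e S (T₁ + T₂) = e S T₁ * e S T₂) ∧
          (∀ T ∈ geomTorsion W m, e T T = 1) ∧
          (∀ T ∈ geomTorsion W m, (∀ S ∈ geomTorsion W m, e S T = 1) → T = 0) ∧
          (∀ σ : Field.absoluteGaloisGroup K, ∀ S ∈ geomTorsion W m, ∀ T ∈ geomTorsion W m,
            e (σ • S) (σ • T) = σ • e S T) ∧
          (∀ φ : Isogeny W W, ∀ S ∈ geomTorsion W m, ∀ P : W.geomPoints,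
            φ P ∈ geomTorsion W m → e (φ S) (φ P) = e S (φ.deg • P)) :=
  Iff.rfl

/-- **`exists_weilPairing_adjoint` refines the tree's `exists_weilPairing`** (Prop. III.8.1
(a)–(d) alone, on the subtype `E[m]`): restrict the pairing to `E[m] × E[m]` and drop
Prop. III.8.2 (and the unused perfectness hypothesis). [cite: SilvermanAEC2009, Prop. III.8.1] -/
theorem exists_weilPairing_of_adjoint (h : W.exists_weilPairing_adjoint m) :
    W.exists_weilPairing m := by
  intro _ _ hm hmK
  obtain ⟨e, hpow, haddl, haddr, halt, hnd, hgal, -⟩ := h hm hmK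
  refine ⟨fun S T ↦ e S T, fun S T ↦ hpow S S.2 T T.2, fun S₁ S₂ T ↦ ?_, fun S T₁ T₂ ↦ ?_,
    fun T ↦ halt T T.2, fun T hT ↦ ?_, fun σ S T ↦ ?_⟩
  · exact haddl S₁ S₁.2 S₂ S₂.2 T T.2
  · exact haddr S S.2 T₁ T₁.2 T₂ T₂.2
  · exact Subtype.ext (hnd T T.2 fun S hS ↦ hT ⟨S, hS⟩)
  · change σ • e S T = e ((σ • S : geomTorsion W (m : ℤ)) : W.geomPoints)
      ((σ • T : geomTorsion W (m : ℤ)) : W.geomPoints)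
    rw [Literature.NumberTheory.EllipticCurves.AddSubgroup.torsionBy.coe_smul, Literature.NumberTheory.EllipticCurves.AddSubgroup.torsionBy.coe_smul]
    exact (hgal σ S S.2 T T.2).symm

end WeierstrassCurve
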